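import Mathlib
import HarnessLib
import Summits.ValiantsHypothesis.ValiantsHypothesis.Theses.MonotoneRestoration
import Literature.Computability.AlgebraicComplexity.ArithCircuit
import Literature.Computability.AlgebraicComplexity.ArithCircuitProofs
import Literature.Computability.AlgebraicComplexity.MonotoneStructure
import Literature.Computability.AlgebraicComplexity.PermanentIrreducible
import Literature.ModelTheory.FiniteModelTheory.CkEquiv
import Summits.ValiantsHypothesis.ValiantsHypothesis.Theorems.MonotoneRestorationMonotoneRestorationQPCosetCount
import Summits.ValiantsHypothesis.ValiantsHypothesis.Theorems.MonotoneRestorationMonotoneRestorationQPSymmetricLB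
import Summits.ValiantsHypothesis.ValiantsHypothesis.Theorems.MonotoneRestorationMonotoneRestorationQPSupportSymmetrisation
import Summits.ValiantsHypothesis.ValiantsHypothesis.Theorems.MonotoneRestorationMonotoneRestorationQPSparseRegime
import Summits.ValiantsHypothesis.ValiantsHypothesis.Theorems.MonotoneRestorationMonotoneRestorationQPBeta
import Literature.Computability.AlgebraicComplexity.SymmetricArithCircuit
import Literature.Computability.AlgebraicComplexity.DawarWilsenach2025Proofs
import Literature.GroupTheory.PermutationGroups.SmallIndexSubgroups
import Summits.ValiantsHypothesis.ValiantsHypothesis.Theorems.MonotoneRestorationQP.Negative.LoadBearing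
import Summits.ValiantsHypothesis.ValiantsHypothesis.Theorems.MonotoneRestorationMonotoneRestorationQPPermSupportCount

/-! TTRL-lite variant V18945 of stmt-ValiantsHypothesis-15886 -/

-- `Summit.ValiantsHypothesis.ValiantsHypothesis.…` is the tree's mandated single-conjunct layout
-- (Sub = Summit), so the duplicated namespace component is intended.
set_option linter.dupNamespace false

namespace Summit.ValiantsHypothesis.ValiantsHypothesis.Theorems

open Summit.ValiantsHypothesis.ValiantsHypothesis.Theses.MonotoneRestoration
open Literature.Computability.AlgebraicComplexity

/-- **TTRL-lite variant V18945 of `stub_mulGate_children_extend`** (membership form of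
"support of a product over `ℝ≥0` is the sumset of the supports"): for
`p q : MvPolynomial (Fin n × Fin n) ℝ≥0` and a monomial `m`,
`m ∈ supp (p * q) ↔ ∃ a ∈ supp p, ∃ b ∈ supp q, a + b = m`.
The direction `→` holds over any semiring (`MvPolynomial.support_mul`); the direction `←` is the
no-cancellation lemma `add_mem_support_mul` — all coefficients are nonnegative, so the `(a, b)`
term of the convolution already makes the coefficient of `a + b` nonzero. [folklore] -/
theorem stub_mulGate_children_extend_var18945 :
    ∀ (n : ℕ) (p q : MvPolynomial (Fin n × Fin n) NNReal) (m : (Fin n × Fin n) →₀ ℕ),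
      m ∈ (p * q).support ↔ ∃ a ∈ p.support, ∃ b ∈ q.support, a + b = m := by
  intro n p q m
  constructor
  · intro hm
    obtain ⟨a, ha, b, hb, hab⟩ := Finset.mem_add.mp (MvPolynomial.support_mul p q hm)
    exact ⟨a, ha, b, hb, hab⟩
  · rintro ⟨a, ha, b, hb, rfl⟩
    exact add_mem_support_mul ha hb

end Summit.ValiantsHypothesis.ValiantsHypothesis.Theorems
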